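import Mathlib.Analysis.SpecialFunctions.JapaneseBracket
import Literature.Analysis.FluidPDE.PeriodicLerayExistence
import Literature.Analysis.FunctionSpaces.WeakCompactnessLpFinite
import HarnessLib

/-!
# [BT1] proof of Theorem 2.4, the limit `ε → 0`, III: the weak `L^{5/3}` limit of the
  pressures on space–time

Analysis/FluidPDE proof file (theorems only, no new definitions, no named facts), third part of
the discharge of the named fact `Literature.Analysis.FluidPDE.bradshawTsai2017_thm_2_4_limit`
(`PeriodicLerayExistence.lean`; Bradshaw–Tsai, Ann. Henri Poincaré 18 (2017) =
arXiv:1510.07504 [BT1], §2, proof of Thm 2.4): "since `p_{ε_k}` are uniformly bounded in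
`L^{5/3}(ℝ³ × [0,T])` we can extract a subsequence (still denoted `p_{ε_k}`) so that
`p_{ε_k} → p` weakly in `L^{5/3}(ℝ³ × [0,T])` for some distribution `p ∈ L^{5/3}(ℝ³ × [0,T])`".

The pressures are `T`-periodic in time, so "bounded in `L^{5/3}(ℝ³ × [0,T])`" means bounded in
`L^{5/3}` of every bounded time window `(a, b) × ℝ³`, never in `L^{5/3}(ℝ × ℝ³)`. This file
extracts **one** subsequence and **one** weak limit on all of `ℝ × ℝ³` at once, by running the
tree's weak compactness theorem for bounded sequences in `L^p` of a *finite* measure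
(`FunctionSpaces.exists_subseq_tendsto_integral_mul_of_lintegral_rpow_le'`, Dunford–Pettis +
de la Vallée-Poussin) on the finite weighted measure
`μ = e^{−|s|} (1 + |y|)^{−5} ds dy` and the reweighted functions `q_k = p_k (1 + |y|)^{3}`
(`∫ |q_k|^{5/3} dμ = ∫∫ e^{−|s|} |p_k|^{5/3} ds dy`, bounded by the window bounds summed over a
geometric series); the weak limit `g ∈ L^{5/3}(μ)` gives `p = g (1 + |y|)^{−3}` with
`∫∫ e^{−|s|} |p|^{5/3} < ∞` and `∫_Q p_k h → ∫_Q p h` for every bounded cylinder `Q` and every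
`h ∈ L^{5/2}(Q)` (test `q_k` against `1_Q h (1+|y|)^{−3} e^{|s|} (1+|y|)^{5} ∈ L^{5/2}(μ)`):

* `lintegral_exp_neg_abs_mul_le_of_window` — `∫∫ e^{−|s|} F ≤ 2K/(1 − e^{−1})` when
  `∫∫_{(a−1,a+1)×ℝ³} F ≤ K` for every `a` (dyadic shells in time and the geometric series);
* `exists_subseq_pressure_limit` — **the extraction**, for any sequence of jointly measurable
  `p_k` with uniform window bounds `∫∫_{(a−1,a+1)×ℝ³} |p_k|^{5/3} ≤ K`.

## References

* Z. Bradshaw, T.-P. Tsai, Ann. Henri Poincaré 18 (2017) 1095–1119 = arXiv:1510.07504, §2,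
  proof of Thm 2.4 ("`p_{ε_k} → p` weakly in `L^{5/3}(ℝ³ × [0,T])`") [BradshawTsai2017AHP].
* H. Brezis, *Functional Analysis, Sobolev Spaces and PDE* (2011), Thm. 3.18, Thm. 4.10,
  Prop. 3.5 (iii) [Brezis2011].
-/

noncomputable section

open MeasureTheory TopologicalSpace Set Function Filter Metric Bornology
open scoped NNReal ENNReal Topology

namespace Literature.Analysis.FluidPDE

namespace BradshawTsai2017

/-! ### The weights -/

section Weights

/-- `e^{−|s|} ≤ 2 (1 + |s|)^{−2}` (from `1 + x + x²/2 ≤ eˣ` for `x ≥ 0`). [folklore] -/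
theorem exp_neg_abs_le (s : ℝ) : Real.exp (-|s|) ≤ 2 * (1 + ‖s‖) ^ (-(2 : ℝ)) := by
  have h0 : 0 ≤ |s| := abs_nonneg s
  have h1 : 1 + |s| + |s| ^ 2 / 2 ≤ Real.exp |s| := Real.quadratic_le_exp_of_nonneg h0
  have h2 : (1 + |s|) ^ 2 / 2 ≤ Real.exp |s| := by nlinarith [h1]
  have hpos : 0 < (1 + |s|) ^ 2 := by positivity
  rw [Real.norm_eq_abs, Real.rpow_neg (by positivity), Real.exp_neg]
  rw [show ((1 + |s|) ^ (2 : ℝ)) = (1 + |s|) ^ (2 : ℕ) by norm_cast]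
  rw [inv_eq_one_div, le_mul_inv_iff₀ hpos, one_div, inv_mul_le_iff₀ (Real.exp_pos _)]
  linarith

/-- The time weight `e^{−|s|}` is integrable on `ℝ`. [folklore] -/
theorem integrable_exp_neg_abs : Integrable (fun s : ℝ => Real.exp (-|s|)) volume := by
  have h : Integrable (fun s : ℝ => (1 + ‖s‖) ^ (-(2 : ℝ))) volume :=
    integrable_one_add_norm (by rw [Module.finrank_self]; norm_num)
  refine (h.const_mul 2).mono' (Real.continuous_exp.comp continuous_abs.neg).aestronglyMeasurable
    (Eventually.of_forall fun s => ?_)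
  rw [Real.norm_eq_abs, abs_of_pos (Real.exp_pos _)]
  exact exp_neg_abs_le s

/-- The space weight `(1 + |y|)^{−5}` is integrable on `ℝ³`. [folklore] -/
theorem integrable_one_add_norm_pow_five_inv :
    Integrable (fun y : EuclideanSpace ℝ (Fin 3) => ((1 + ‖y‖) ^ 5)⁻¹) volume := by
  have h : Integrable (fun y : EuclideanSpace ℝ (Fin 3) => (1 + ‖y‖) ^ (-(5 : ℝ))) volume :=
    integrable_one_add_norm (by rw [finrank_euclideanSpace_fin]; norm_num)
  refine h.congr (Eventually.of_forall fun y => ?_)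
  show (1 + ‖y‖) ^ (-(5 : ℝ)) = ((1 + ‖y‖) ^ 5)⁻¹
  rw [Real.rpow_neg (by positivity), ← Real.rpow_natCast]
  norm_num

/-- **The space–time weight `d(s, y) = e^{−|s|} (1 + |y|)^{−5}` is integrable** on `ℝ × ℝ³`, so
`d · (ds dy)` is a finite measure. [folklore] -/
theorem integrable_weight :
    Integrable (fun z : ℝ × EuclideanSpace ℝ (Fin 3) => Real.exp (-|z.1|) * ((1 + ‖z.2‖) ^ 5)⁻¹)
      (volume : Measure (ℝ × EuclideanSpace ℝ (Fin 3))) := by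
  rw [Measure.volume_eq_prod]
  exact integrable_exp_neg_abs.mul_prod integrable_one_add_norm_pow_five_inv

/-- The weight is positive. [folklore] -/
theorem weight_pos (z : ℝ × EuclideanSpace ℝ (Fin 3)) :
    0 < Real.exp (-|z.1|) * ((1 + ‖z.2‖) ^ 5)⁻¹ :=
  mul_pos (Real.exp_pos _) (inv_pos.2 (by positivity))

/-- The weight is continuous. [folklore] -/
theorem continuous_weight :
    Continuous fun z : ℝ × EuclideanSpace ℝ (Fin 3) => Real.exp (-|z.1|) * ((1 + ‖z.2‖) ^ 5)⁻¹ := by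
  refine (Real.continuous_exp.comp (continuous_abs.comp continuous_fst).neg).mul ?_
  refine ((continuous_const.add (continuous_norm.comp continuous_snd)).pow 5).inv₀ fun z => ?_
  exact (pow_pos (add_pos_of_pos_of_nonneg one_pos (norm_nonneg _)) 5).ne'

end Weights

/-! ### The time weight against the window bounds -/

section Shells

/-- **The time weight against uniform window bounds**: if `∫∫_{(a−1,a+1)×ℝ³} F ≤ K` for every
`a`, then `∫∫ e^{−|s|} F(s, y) ds dy ≤ 2K (1 − e^{−1})⁻¹` (cover `ℝ` by the shells
`m ≤ |s| < m + 1`, on which `e^{−|s|} ≤ e^{−m}`, and sum the geometric series). [folklore] -/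
theorem lintegral_exp_neg_abs_mul_le_of_window {F : ℝ × EuclideanSpace ℝ (Fin 3) → ℝ≥0∞}
    (hF : AEMeasurable F (volume : Measure (ℝ × EuclideanSpace ℝ (Fin 3)))) {K : ℝ≥0∞}
    (hK : ∀ a : ℝ, ∫⁻ z in Ioo (a - 1) (a + 1) ×ˢ (univ : Set (EuclideanSpace ℝ (Fin 3))), F z ≤ K) :
    ∫⁻ z, ENNReal.ofReal (Real.exp (-|z.1|)) * F z ≤
      2 * K * (1 - ENNReal.ofReal (Real.exp (-1)))⁻¹ := by
  set c : ℝ≥0∞ := ENNReal.ofReal (Real.exp (-1)) with hc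
  -- the shells
  set B : ℕ → Set (ℝ × EuclideanSpace ℝ (Fin 3)) := fun m =>
    (Ioo ((m : ℝ) - 1) ((m : ℝ) + 1) ∪ Ioo (-(m : ℝ) - 1) (-(m : ℝ) + 1)) ×ˢ univ with hB
  have hBm : ∀ m, MeasurableSet (B m) := fun m =>
    (measurableSet_Ioo.union measurableSet_Ioo).prod MeasurableSet.univ
  -- pointwise domination of the weight by the shell series
  have hpt : ∀ z : ℝ × EuclideanSpace ℝ (Fin 3), ENNReal.ofReal (Real.exp (-|z.1|)) ≤
      ∑' m : ℕ, c ^ m * (B m).indicator (fun _ => (1 : ℝ≥0∞)) z := by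
    intro z
    set m₀ : ℕ := ⌊|z.1|⌋₊ with hm₀
    have h1 : (m₀ : ℝ) ≤ |z.1| := Nat.floor_le (abs_nonneg _)
    have h2 : |z.1| < m₀ + 1 := Nat.lt_floor_add_one _
    have hzB : z ∈ B m₀ := by
      refine ⟨?_, mem_univ _⟩
      rcases le_or_gt 0 z.1 with hz | hz
      · left
        rw [abs_of_nonneg hz] at h1 h2
        exact ⟨by linarith, h2⟩
      · right
        rw [abs_of_neg hz] at h1 h2
        exact ⟨by linarith, by linarith⟩
    refine le_trans ?_ (ENNReal.le_tsum m₀)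
    rw [indicator_of_mem hzB, mul_one, hc, ← ENNReal.ofReal_pow (Real.exp_pos _).le,
      ← Real.exp_nat_mul, mul_neg, mul_one]
    exact ENNReal.ofReal_le_ofReal (Real.exp_le_exp.2 (neg_le_neg h1))
  -- the shell integrals
  have hshell : ∀ m, ∫⁻ z in B m, F z ≤ 2 * K := by
    intro m
    rw [hB]
    dsimp only
    rw [union_prod]
    refine (lintegral_union_le _ _ _).trans ?_
    rw [two_mul]
    refine add_le_add ?_ ?_
    · exact hK m
    · have := hK (-(m : ℝ))
      exact this
  -- integrate the domination
  have hmeas : ∀ m, AEMeasurable (fun z => (B m).indicator (fun _ => (1 : ℝ≥0∞)) z * F z)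
      (volume : Measure (ℝ × EuclideanSpace ℝ (Fin 3))) := fun m =>
    ((aemeasurable_indicator_const_iff (1 : ℝ≥0∞)).2 (hBm m).nullMeasurableSet).mul hF
  calc ∫⁻ z, ENNReal.ofReal (Real.exp (-|z.1|)) * F z
      ≤ ∫⁻ z, (∑' m : ℕ, c ^ m * (B m).indicator (fun _ => (1 : ℝ≥0∞)) z) * F z :=
        lintegral_mono fun z => mul_le_mul' (hpt z) le_rfl
    _ = ∫⁻ z, ∑' m : ℕ, c ^ m * ((B m).indicator (fun _ => (1 : ℝ≥0∞)) z * F z) := by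
        refine lintegral_congr fun z => ?_
        rw [← ENNReal.tsum_mul_right]
        simp only [mul_assoc]
    _ = ∑' m : ℕ, ∫⁻ z, c ^ m * ((B m).indicator (fun _ => (1 : ℝ≥0∞)) z * F z) :=
        lintegral_tsum fun m => (hmeas m).const_mul _
    _ = ∑' m : ℕ, c ^ m * ∫⁻ z in B m, F z := by
        refine tsum_congr fun m => ?_
        rw [lintegral_const_mul'' _ (hmeas m), ← lintegral_indicator (hBm m)]
        congr 1
        refine lintegral_congr fun z => ?_
        by_cases hz : z ∈ B m
        · rw [indicator_of_mem hz, indicator_of_mem hz, one_mul]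
        · rw [indicator_of_notMem hz, indicator_of_notMem hz, zero_mul]
    _ ≤ ∑' m : ℕ, c ^ m * (2 * K) := ENNReal.tsum_le_tsum fun m => mul_le_mul' le_rfl (hshell m)
    _ = 2 * K * (1 - c)⁻¹ := by
        rw [ENNReal.tsum_mul_right, ENNReal.tsum_geometric, mul_comm]

/-- The constant `2K(1 − e^{−1})⁻¹` is finite when `K` is. [folklore] -/
theorem shellBound_ne_top {K : ℝ≥0∞} (hK : K ≠ ∞) :
    2 * K * (1 - ENNReal.ofReal (Real.exp (-1)))⁻¹ ≠ ∞ := by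
  refine ENNReal.mul_ne_top (ENNReal.mul_ne_top ENNReal.ofNat_ne_top hK) ?_
  rw [Ne, ENNReal.inv_eq_top, tsub_eq_zero_iff_le, not_le, ENNReal.ofReal_lt_one]
  exact Real.exp_lt_one_iff.2 (by norm_num)

end Shells

/-! ### The extraction -/

section Extraction

/-- `((1 + |y|)³)^{5/3} = (1 + |y|)⁵`. [folklore] -/
theorem pow_three_rpow_five_thirds (y : EuclideanSpace ℝ (Fin 3)) :
    ((1 + ‖y‖) ^ 3) ^ (5 / 3 : ℝ) = (1 + ‖y‖) ^ 5 := by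
  have hA : 0 ≤ 1 + ‖y‖ := by positivity
  rw [show ((1 + ‖y‖) ^ 3 : ℝ) = (1 + ‖y‖) ^ (3 : ℝ) by norm_cast, ← Real.rpow_mul hA,
    show ((3 : ℝ) * (5 / 3)) = (5 : ℕ) by norm_num, Real.rpow_natCast]

/-- **The reweighting cancels the spatial weight**: pointwise,
`d(s,y) |x (1+|y|)³|^{5/3} = e^{−|s|} |x|^{5/3}` in `ℝ≥0∞`. [folklore] -/
theorem weight_mul_enorm_reweight_rpow (z : ℝ × EuclideanSpace ℝ (Fin 3)) (x : ℝ) :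
    ENNReal.ofReal (Real.exp (-|z.1|) * ((1 + ‖z.2‖) ^ 5)⁻¹) *
        ‖x * (1 + ‖z.2‖) ^ 3‖ₑ ^ (5 / 3 : ℝ) =
      ENNReal.ofReal (Real.exp (-|z.1|)) * ‖x‖ₑ ^ (5 / 3 : ℝ) := by
  have hA3 : (0 : ℝ) ≤ (1 + ‖z.2‖) ^ 3 := by positivity
  have hA5 : (0 : ℝ) < (1 + ‖z.2‖) ^ 5 := by positivity
  have hcancel : ENNReal.ofReal (((1 + ‖z.2‖) ^ 5)⁻¹) * ENNReal.ofReal ((1 + ‖z.2‖) ^ 5) = 1 := by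
    rw [← ENNReal.ofReal_mul (inv_nonneg.2 hA5.le), inv_mul_cancel₀ hA5.ne', ENNReal.ofReal_one]
  rw [ENNReal.ofReal_mul (Real.exp_pos _).le, enorm_mul, Real.enorm_eq_ofReal hA3,
    ENNReal.mul_rpow_of_nonneg _ _ (by norm_num), ENNReal.ofReal_rpow_of_nonneg hA3 (by norm_num),
    pow_three_rpow_five_thirds]
  calc ENNReal.ofReal (Real.exp (-|z.1|)) * ENNReal.ofReal (((1 + ‖z.2‖) ^ 5)⁻¹) *
        (‖x‖ₑ ^ (5 / 3 : ℝ) * ENNReal.ofReal ((1 + ‖z.2‖) ^ 5))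
      = ENNReal.ofReal (Real.exp (-|z.1|)) * ‖x‖ₑ ^ (5 / 3 : ℝ) *
          (ENNReal.ofReal (((1 + ‖z.2‖) ^ 5)⁻¹) * ENNReal.ofReal ((1 + ‖z.2‖) ^ 5)) := by ring
    _ = ENNReal.ofReal (Real.exp (-|z.1|)) * ‖x‖ₑ ^ (5 / 3 : ℝ) := by rw [hcancel, mul_one]

/-- **The un-weighting of the limit**: pointwise,
`e^{−|s|} |x (1+|y|)^{−3}|^{5/3} = d(s,y) |x|^{5/3}` in `ℝ≥0∞`. [folklore] -/
theorem exp_mul_enorm_unweight_rpow (z : ℝ × EuclideanSpace ℝ (Fin 3)) (x : ℝ) :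
    ENNReal.ofReal (Real.exp (-|z.1|)) * ‖x * ((1 + ‖z.2‖) ^ 3)⁻¹‖ₑ ^ (5 / 3 : ℝ) =
      ENNReal.ofReal (Real.exp (-|z.1|) * ((1 + ‖z.2‖) ^ 5)⁻¹) * ‖x‖ₑ ^ (5 / 3 : ℝ) := by
  have hA3 : (0 : ℝ) ≤ (1 + ‖z.2‖) ^ 3 := by positivity
  have hA3' : (0 : ℝ) ≤ ((1 + ‖z.2‖) ^ 3)⁻¹ := inv_nonneg.2 hA3
  rw [ENNReal.ofReal_mul (Real.exp_pos _).le, enorm_mul, Real.enorm_eq_ofReal hA3',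
    ENNReal.mul_rpow_of_nonneg _ _ (by norm_num), ENNReal.ofReal_rpow_of_nonneg hA3' (by norm_num),
    Real.inv_rpow hA3, pow_three_rpow_five_thirds]
  ring

/-- `(5/3, 5/2)` are Hölder conjugate. [folklore] -/
theorem holderConjugate_fiveThirds : (5 / 3 : ℝ).HolderConjugate (5 / 2) :=
  Real.holderConjugate_iff.2 ⟨by norm_num, by norm_num⟩

/-- **The weak `L^{5/3}` limit of the pressures on space–time** ([BT1], proof of Thm 2.4:
"`p_{ε_k} → p` weakly in `L^{5/3}(ℝ³ × [0,T])` for some distribution `p ∈ L^{5/3}(ℝ³ × [0,T])`";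
Brezis 2011, Thm. 3.18). Let `p_k` be jointly measurable on `ℝ × ℝ³` with the uniform window
bounds `∫∫_{(a−1,a+1)×ℝ³} |p_k|^{5/3} ≤ K < ∞` for all `a` and `k`. Then along a subsequence `σ`
there is a jointly measurable `p` on `ℝ × ℝ³` with `∫∫ e^{−|s|} |p|^{5/3} ≤ 2K(1 − e^{−1})⁻¹`
(so `p ∈ L^{5/3}((a,b) × ℝ³)` for every bounded window, with the bound
`e^{max(|a|,|b|)} · 2K(1 − e^{−1})⁻¹`), and `∫_Q p_{σ k} h → ∫_Q p h` for every bounded cylinder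
`Q = (a, b) × B(0, R)` and every `h ∈ L^{5/2}(Q)` — weak convergence in `L^{5/3}(Q)` for all `Q`
at once (weak compactness in `L^{5/3}` of the finite measure `e^{−|s|}(1+|y|)^{−5} ds dy` for the
reweighted `p_k (1+|y|)³`). [cite: BradshawTsai2017AHP, proof of Thm 2.4 ("p_{ε_k} → p weakly in L^{5/3}")] -/
theorem exists_subseq_pressure_limit {π : ℕ → ℝ → EuclideanSpace ℝ (Fin 3) → ℝ}
    (hπm : ∀ k, AEStronglyMeasurable (uncurry (π k)) (volume : Measure (ℝ × EuclideanSpace ℝ (Fin 3))))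
    {K : ℝ≥0∞} (hK : K ≠ ∞)
    (hπb : ∀ k (a : ℝ), ∫⁻ z in Ioo (a - 1) (a + 1) ×ˢ (univ : Set (EuclideanSpace ℝ (Fin 3))),
      ‖π k z.1 z.2‖ₑ ^ (5 / 3 : ℝ) ≤ K) :
    ∃ (σ : ℕ → ℕ) (p : ℝ → EuclideanSpace ℝ (Fin 3) → ℝ), StrictMono σ ∧
      AEStronglyMeasurable (uncurry p) (volume : Measure (ℝ × EuclideanSpace ℝ (Fin 3))) ∧
      ∫⁻ z : ℝ × EuclideanSpace ℝ (Fin 3), ENNReal.ofReal (Real.exp (-|z.1|)) * ‖p z.1 z.2‖ₑ ^ (5 / 3 : ℝ) ≤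
        2 * K * (1 - ENNReal.ofReal (Real.exp (-1)))⁻¹ ∧
      (∀ a b : ℝ, ∫⁻ z in Ioo a b ×ˢ (univ : Set (EuclideanSpace ℝ (Fin 3))), ‖p z.1 z.2‖ₑ ^ (5 / 3 : ℝ) ≤
        ENNReal.ofReal (Real.exp (max |a| |b|)) * (2 * K * (1 - ENNReal.ofReal (Real.exp (-1)))⁻¹)) ∧
      ∀ (a b R : ℝ) (h : ℝ × EuclideanSpace ℝ (Fin 3) → ℝ),
        MemLp h (5 / 2 : ℝ≥0∞) (volume.restrict (Ioo a b ×ˢ ball (0 : EuclideanSpace ℝ (Fin 3)) R)) →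
        Tendsto (fun k => ∫ z in Ioo a b ×ˢ ball (0 : EuclideanSpace ℝ (Fin 3)) R, π (σ k) z.1 z.2 * h z)
          atTop (𝓝 (∫ z in Ioo a b ×ˢ ball (0 : EuclideanSpace ℝ (Fin 3)) R, p z.1 z.2 * h z)) := by
  -- the weighted finite measure
  set d : ℝ × EuclideanSpace ℝ (Fin 3) → ℝ := fun z => Real.exp (-|z.1|) * ((1 + ‖z.2‖) ^ 5)⁻¹ with hd
  set μ : Measure (ℝ × EuclideanSpace ℝ (Fin 3)) := volume.withDensity fun z => ENNReal.ofReal (d z)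
    with hμ
  haveI : IsFiniteMeasure μ := isFiniteMeasure_withDensity_ofReal integrable_weight.2
  have hdpos : ∀ z, 0 < d z := weight_pos
  have hdc : Continuous d := continuous_weight
  have hdm : Measurable fun z => ENNReal.ofReal (d z) := hdc.measurable.ennreal_ofReal
  have hac : μ ≪ volume := withDensity_absolutelyContinuous _ _
  have hac' : (volume : Measure (ℝ × EuclideanSpace ℝ (Fin 3))) ≪ μ :=
    withDensity_absolutelyContinuous' hdm.aemeasurable
      (Eventually.of_forall fun z => (ENNReal.ofReal_pos.2 (hdpos z)).ne')
  have hA : ∀ y : EuclideanSpace ℝ (Fin 3), 0 < 1 + ‖y‖ := fun y => by positivity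
  have hcA : Continuous fun z : ℝ × EuclideanSpace ℝ (Fin 3) => (1 + ‖z.2‖) ^ 3 :=
    (continuous_const.add (continuous_norm.comp continuous_snd)).pow 3
  have hcAi : Continuous fun z : ℝ × EuclideanSpace ℝ (Fin 3) => ((1 + ‖z.2‖) ^ 3)⁻¹ :=
    hcA.inv₀ fun z => (pow_pos (hA z.2) 3).ne'
  -- the reweighted functions and their uniform `L^{5/3}(μ)` bound
  set q : ℕ → ℝ × EuclideanSpace ℝ (Fin 3) → ℝ := fun k z => π k z.1 z.2 * (1 + ‖z.2‖) ^ 3 with hq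
  have hqm₀ : ∀ k, AEStronglyMeasurable (q k) (volume : Measure (ℝ × EuclideanSpace ℝ (Fin 3))) :=
    fun k => (hπm k).mul hcA.aestronglyMeasurable
  have hqm : ∀ k, AEStronglyMeasurable (q k) μ := fun k => (hqm₀ k).mono_ac hac
  set Kμ : ℝ≥0∞ := 2 * K * (1 - ENNReal.ofReal (Real.exp (-1)))⁻¹ with hKμ
  have hKμtop : Kμ ≠ ∞ := shellBound_ne_top hK
  have hqb : ∀ k, ∫⁻ z, ‖q k z‖ₑ ^ (5 / 3 : ℝ) ∂μ ≤ Kμ := by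
    intro k
    rw [hμ, lintegral_withDensity_eq_lintegral_mul₀ hdm.aemeasurable ((hqm₀ k).enorm.pow_const _)]
    have e : (fun z => ((fun z => ENNReal.ofReal (d z)) * fun z => ‖q k z‖ₑ ^ (5 / 3 : ℝ)) z) =
        fun z => ENNReal.ofReal (Real.exp (-|z.1|)) * ‖π k z.1 z.2‖ₑ ^ (5 / 3 : ℝ) := by
      funext z
      exact weight_mul_enorm_reweight_rpow z (π k z.1 z.2)
    rw [e]
    exact lintegral_exp_neg_abs_mul_le_of_window ((hπm k).enorm.pow_const _) (hπb k)
  -- weak compactness in `L^{5/3}(μ)`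
  obtain ⟨σ, hσ, g, hgmem, hgb, hgw⟩ :=
    FunctionSpaces.exists_subseq_tendsto_integral_mul_of_lintegral_rpow_le' (μ := μ)
      holderConjugate_fiveThirds hqm hKμtop hqb
  -- the limit pressure
  set p : ℝ → EuclideanSpace ℝ (Fin 3) → ℝ := fun s y => g (s, y) * ((1 + ‖y‖) ^ 3)⁻¹ with hp
  have hpunc : uncurry p = fun z => g z * ((1 + ‖z.2‖) ^ 3)⁻¹ := by
    funext z; rfl
  have hgm₀ : AEStronglyMeasurable g (volume : Measure (ℝ × EuclideanSpace ℝ (Fin 3))) :=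
    hgmem.1.mono_ac hac'
  have hpm : AEStronglyMeasurable (uncurry p) (volume : Measure (ℝ × EuclideanSpace ℝ (Fin 3))) := by
    rw [hpunc]; exact hgm₀.mul hcAi.aestronglyMeasurable
  -- the weighted bound of the limit
  have hpb : ∫⁻ z : ℝ × EuclideanSpace ℝ (Fin 3),
      ENNReal.ofReal (Real.exp (-|z.1|)) * ‖p z.1 z.2‖ₑ ^ (5 / 3 : ℝ) ≤ Kμ := by
    have e : (fun z : ℝ × EuclideanSpace ℝ (Fin 3) =>
        ENNReal.ofReal (Real.exp (-|z.1|)) * ‖p z.1 z.2‖ₑ ^ (5 / 3 : ℝ)) =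
        fun z => ((fun z => ENNReal.ofReal (d z)) * fun z => ‖g z‖ₑ ^ (5 / 3 : ℝ)) z := by
      funext z
      exact exp_mul_enorm_unweight_rpow z (g z)
    rw [e, ← lintegral_withDensity_eq_lintegral_mul₀ hdm.aemeasurable (hgm₀.enorm.pow_const _)]
    exact hgb
  refine ⟨σ, p, hσ, hpm, hpb, fun a b => ?_, fun a b R h hh => ?_⟩
  · -- the window bound: `e^{-|s|} ≥ e^{-max(|a|,|b|)}` on `(a, b)`
    set L : ℝ := max |a| |b| with hL
    have hwin : ∀ z : ℝ × EuclideanSpace ℝ (Fin 3), z ∈ Ioo a b ×ˢ (univ : Set (EuclideanSpace ℝ (Fin 3))) →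
        ‖p z.1 z.2‖ₑ ^ (5 / 3 : ℝ) ≤
          ENNReal.ofReal (Real.exp L) * (ENNReal.ofReal (Real.exp (-|z.1|)) * ‖p z.1 z.2‖ₑ ^ (5 / 3 : ℝ)) := by
      intro z hz
      have hs : |z.1| ≤ L := abs_le.2 ⟨by
        have := neg_abs_le a; have := le_max_left |a| |b|; linarith [hz.1.1], by
        have := le_abs_self b; have := le_max_right |a| |b|; linarith [hz.1.2]⟩
      rw [← mul_assoc, ← ENNReal.ofReal_mul (Real.exp_pos _).le, ← Real.exp_add]
      have h1 : (1 : ℝ≥0∞) ≤ ENNReal.ofReal (Real.exp (L + -|z.1|)) := by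
        rw [← ENNReal.ofReal_one]
        exact ENNReal.ofReal_le_ofReal (Real.one_le_exp (by linarith))
      calc ‖p z.1 z.2‖ₑ ^ (5 / 3 : ℝ) = 1 * ‖p z.1 z.2‖ₑ ^ (5 / 3 : ℝ) := (one_mul _).symm
        _ ≤ ENNReal.ofReal (Real.exp (L + -|z.1|)) * ‖p z.1 z.2‖ₑ ^ (5 / 3 : ℝ) :=
            mul_le_mul' h1 le_rfl
    calc ∫⁻ z in Ioo a b ×ˢ (univ : Set (EuclideanSpace ℝ (Fin 3))), ‖p z.1 z.2‖ₑ ^ (5 / 3 : ℝ)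
        ≤ ∫⁻ z in Ioo a b ×ˢ (univ : Set (EuclideanSpace ℝ (Fin 3))),
            ENNReal.ofReal (Real.exp L) * (ENNReal.ofReal (Real.exp (-|z.1|)) * ‖p z.1 z.2‖ₑ ^ (5 / 3 : ℝ)) :=
          setLIntegral_mono' (measurableSet_Ioo.prod MeasurableSet.univ) hwin
      _ ≤ ∫⁻ z : ℝ × EuclideanSpace ℝ (Fin 3),
            ENNReal.ofReal (Real.exp L) * (ENNReal.ofReal (Real.exp (-|z.1|)) * ‖p z.1 z.2‖ₑ ^ (5 / 3 : ℝ)) :=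
          setLIntegral_le_lintegral _ _
      _ = ENNReal.ofReal (Real.exp L) *
            ∫⁻ z : ℝ × EuclideanSpace ℝ (Fin 3), ENNReal.ofReal (Real.exp (-|z.1|)) * ‖p z.1 z.2‖ₑ ^ (5 / 3 : ℝ) := by
          have hm : AEMeasurable (fun z : ℝ × EuclideanSpace ℝ (Fin 3) =>
              ENNReal.ofReal (Real.exp (-|z.1|)) * ‖p z.1 z.2‖ₑ ^ (5 / 3 : ℝ)) volume :=
            ((Real.continuous_exp.comp (continuous_abs.comp continuous_fst).neg).measurable.ennreal_ofReal.aemeasurable).mul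
              (hpm.enorm.pow_const _)
          rw [lintegral_const_mul'' _ hm]
      _ ≤ ENNReal.ofReal (Real.exp L) * Kμ := mul_le_mul' le_rfl hpb
  · -- weak convergence on the cylinder `Q = (a, b) × B(0, R)`
    set Q : Set (ℝ × EuclideanSpace ℝ (Fin 3)) := Ioo a b ×ˢ ball (0 : EuclideanSpace ℝ (Fin 3)) R with hQ
    have hQm : MeasurableSet Q := measurableSet_Ioo.prod measurableSet_ball
    -- the test function against `μ`
    set H : ℝ × EuclideanSpace ℝ (Fin 3) → ℝ := fun z => Q.indicator h z * (((1 + ‖z.2‖) ^ 3)⁻¹ * (d z)⁻¹)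
      with hH
    have hhm : AEStronglyMeasurable (Q.indicator h) (volume : Measure (ℝ × EuclideanSpace ℝ (Fin 3))) :=
      (aestronglyMeasurable_indicator_iff hQm).2 hh.1
    have hHm₀ : AEStronglyMeasurable H (volume : Measure (ℝ × EuclideanSpace ℝ (Fin 3))) :=
      hhm.mul (hcAi.mul (hdc.inv₀ fun z => (hdpos z).ne')).aestronglyMeasurable
    -- uniform bound of the factor on `Q`: `(1+|y|)^{-3} d^{-1} ≤ e^{L} (1+R')⁵`
    set L : ℝ := max |a| |b| with hL
    set M : ℝ := Real.exp L * (1 + |R|) ^ 5 with hM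
    have hM0 : 0 ≤ M := by positivity
    have hfac : ∀ z ∈ Q, |((1 + ‖z.2‖) ^ 3)⁻¹ * (d z)⁻¹| ≤ M := by
      intro z hz
      have hs : |z.1| ≤ L := abs_le.2 ⟨by
        have := neg_abs_le a; have := le_max_left |a| |b|; linarith [hz.1.1], by
        have := le_abs_self b; have := le_max_right |a| |b|; linarith [hz.1.2]⟩
      have hy : ‖z.2‖ ≤ |R| := by
        have h1 : ‖z.2‖ < R := by simpa using hz.2
        exact h1.le.trans (le_abs_self R)
      have hA1 : (1 : ℝ) ≤ (1 + ‖z.2‖) ^ 3 := one_le_pow₀ (by linarith [norm_nonneg z.2])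
      have hA5 : (1 + ‖z.2‖) ^ 5 ≤ (1 + |R|) ^ 5 := by gcongr
      rw [abs_of_nonneg (mul_nonneg (inv_nonneg.2 (by positivity)) (inv_nonneg.2 (hdpos z).le)),
        hd]
      dsimp only
      rw [mul_inv, inv_inv, ← Real.exp_neg, neg_neg]
      calc ((1 + ‖z.2‖) ^ 3)⁻¹ * (Real.exp |z.1| * (1 + ‖z.2‖) ^ 5)
          ≤ 1 * (Real.exp L * (1 + |R|) ^ 5) := by
            refine mul_le_mul (inv_le_one_of_one_le₀ hA1) (mul_le_mul (Real.exp_le_exp.2 hs) hA5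
              (by positivity) (Real.exp_pos _).le) (by positivity) zero_le_one
        _ = M := one_mul _
    have hHle : ∀ z, ‖H z‖ ≤ M * ‖Q.indicator h z‖ := by
      intro z
      by_cases hz : z ∈ Q
      · rw [hH]
        dsimp only
        rw [norm_mul, mul_comm, Real.norm_eq_abs (_ * _)]
        exact mul_le_mul_of_nonneg_right (hfac z hz) (norm_nonneg _)
      · rw [hH]
        dsimp only
        rw [indicator_of_notMem hz, zero_mul, norm_zero, mul_zero]
    -- `H ∈ L^{5/2}(μ)`
    have h52 : ENNReal.ofReal (5 / 2) = (5 / 2 : ℝ≥0∞) := by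
      rw [ENNReal.ofReal_div_of_pos (by norm_num)]; simp
    have hHmem : MemLp H (ENNReal.ofReal (5 / 2)) μ := by
      rw [h52]
      refine ⟨hHm₀.mono_ac hac, ?_⟩
      -- `∫ |H|^{5/2} dμ ≤ M^{5/2} ∫_Q |h|^{5/2}` since `d ≤ 1`
      have hd1 : ∀ z, d z ≤ 1 := fun z => by
        rw [hd]
        dsimp only
        have h1 : Real.exp (-|z.1|) ≤ 1 := Real.exp_le_one_iff.2 (neg_nonpos.2 (abs_nonneg _))
        have h2 : ((1 + ‖z.2‖) ^ 5)⁻¹ ≤ 1 := inv_le_one_of_one_le₀ (one_le_pow₀ (by linarith [norm_nonneg z.2]))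
        exact mul_le_one₀ h1 (inv_nonneg.2 (by positivity)) h2
      have hle : eLpNorm H (5 / 2 : ℝ≥0∞) μ ≤ eLpNorm H (5 / 2 : ℝ≥0∞) volume := by
        refine eLpNorm_mono_measure _ ?_
        rw [hμ]
        refine (withDensity_mono (Eventually.of_forall fun z => ?_)).trans (by rw [withDensity_one])
        exact ENNReal.ofReal_le_one.2 (hd1 z)
      refine lt_of_le_of_lt hle ?_
      have hle2 : eLpNorm H (5 / 2 : ℝ≥0∞) volume ≤ ENNReal.ofReal M * eLpNorm (Q.indicator h) (5 / 2 : ℝ≥0∞) volume := by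
        refine eLpNorm_le_mul_eLpNorm_of_ae_le_mul (Eventually.of_forall fun z => ?_) _
        exact hHle z
      refine lt_of_le_of_lt hle2 (ENNReal.mul_lt_top ENNReal.ofReal_lt_top ?_)
      rw [eLpNorm_indicator_eq_eLpNorm_restrict hQm]
      exact hh.2
    -- the pairings against `μ` are the pairings over `Q`
    have hdnn : ∀ z, (d z).toNNReal = ⟨d z, (hdpos z).le⟩ := fun z => Real.toNNReal_of_nonneg (hdpos z).le
    have hpair : ∀ f : ℝ × EuclideanSpace ℝ (Fin 3) → ℝ,
        ∫ z, (f z * (1 + ‖z.2‖) ^ 3) * H z ∂μ = ∫ z in Q, f z * h z := by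
      intro f
      have hdn : Measurable fun z => (d z).toNNReal := hdc.measurable.real_toNNReal
      have e1 : μ = volume.withDensity (fun z => ((d z).toNNReal : ℝ≥0∞)) := by
        rw [hμ]; rfl
      rw [e1, integral_withDensity_eq_integral_smul hdn, ← integral_indicator hQm]
      refine integral_congr_ae (Eventually.of_forall fun z => ?_)
      show (d z).toNNReal • (f z * (1 + ‖z.2‖) ^ 3 * H z) = Q.indicator (fun z => f z * h z) z
      rw [NNReal.smul_def, Real.coe_toNNReal _ (hdpos z).le, smul_eq_mul, hH]
      dsimp only
      by_cases hz : z ∈ Q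
      · rw [indicator_of_mem hz, indicator_of_mem hz]
        have hA3 : ((1 + ‖z.2‖) ^ 3 : ℝ) ≠ 0 := (pow_pos (hA z.2) 3).ne'
        field_simp [(hdpos z).ne', hA3]
      · rw [indicator_of_notMem hz, indicator_of_notMem hz]
        simp
    have hlim := hgw H hHmem
    have eσ : ∀ k, ∫ z, q (σ k) z * H z ∂μ = ∫ z in Q, π (σ k) z.1 z.2 * h z := fun k =>
      hpair (fun z => π (σ k) z.1 z.2)
    have eg : ∫ z, g z * H z ∂μ = ∫ z in Q, p z.1 z.2 * h z := by
      have e2 : (fun z => g z * H z) = fun z => (p z.1 z.2 * (1 + ‖z.2‖) ^ 3) * H z := by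
        funext z
        rw [hp]
        dsimp only
        rw [mul_assoc (g (z.1, z.2)), inv_mul_cancel₀ (pow_pos (hA z.2) 3).ne', mul_one]
      rw [e2]
      exact hpair (fun z => p z.1 z.2)
    simp only [eσ] at hlim
    rw [eg] at hlim
    exact hlim

end Extraction

end BradshawTsai2017

end Literature.Analysis.FluidPDE

end
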